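import Mathlib
import Literature.MathematicalPhysics.QuantumFieldTheory.Balaban1983to89.B1Eq324BenfattoClassAppendixC
import HarnessLib

/-!
# `Balaban1983to89.B1Eq324BenfattoClassMarkov` — the MARKOV rows of [BenfattoEtAl1978] (Commun. Math. Phys. **59** (1978) 143–166:
# (3.18) p. 150, App. C 2) (C.6)–(C.7) p. 164 «C^Γ is the covariance with “Dirichlet boundary condition” on Γ») FOR A CLASS: a Gaussian
# vector whose PRECISION has no entries across a partition of `Γᶜ` has, given the coordinates in `Γ`, ZERO conditional covariance across
# the partition and a conditional centre that reads only the adjacent boundary data — PROVED for every positive definite precision on a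
# finite index set (precision form; sequel of `B1Eq324BenfattoClassAppendixC`)

statement-level skeleton of published theorems with citation tags; proofs where landed; nothing here is a claim about the
Yang–Mills mass gap

WHY THIS MODULE (cell `pub-ymgap`, seat `dag-n08-b` gen 7).  The kernel dependence census of `basicLemmaPrinted_holds`
(`HOME/pub-ymgap-dag-n08-c/N08-BASICLEMMA-KERNEL-CENSUS.md`, seat dag-n08-c g21, 2026-08-28) lists the free-field inputs of the §5 road of
[BenfattoEtAl1978]: besides Appendix A / Appendix C / translation, three MARKOV statements (row (M)): independence of Γ-enclosed regions under the
conditioned field (`B1Eq324BenfattoMarkov.iIndepFun_condField_of_enclosed`), locality of the conditional mean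
(`condMean_freeCov_congr_of_enclosed`) and its boundary-sum form (`condMean_freeCov_eq_boundary_sum`) — in the tree all three are proved
from the nearest-neighbour LATTICE EQUATION of the concrete field (1.1).  For a Gaussian measure of the kind [Balaban1985UV3] (58) integrates
(«determined by the quadratic form ⟨A, Δ_kA⟩», p. 271) the honest hypothesis is on the PRECISION: finite range (or none at all across a wide
corridor).  `B1Eq324BenfattoClassAppendixC` §4 identified the conditional covariance with the inverse of the principal precision block,
`C^Γ = (A|_{Γᶜ})⁻¹`, and the conditional centre with `−(A|_{Γᶜ})⁻¹A_{ΓᶜΓ}ξ` (print's (C.7)); this file adds the one linear-algebra fact «the inverse of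
a matrix with no entries across a partition has no entries across it» and reads off the covariance-level Markov property and the locality of the
centre for EVERY positive definite precision — the (M) rows in class form at the covariance level (the measure level — uncorrelated jointly Gaussian
blocks are independent — is generic Gaussian and not typed here).

THE PRINTED TEXT being generalised (p. 164, verbatim): *"2) Let Γ be a region paved by Q₀ and let P̂₀(dz|z_Γ) denotes the above probability measure
conditioned to fixed values of the z_Δ's, Δ ∈ Γ. Then the conditioned variables (z_Δ)_{Δ∉Γ} are a non centered gaussian field with covariance C^Γ_{ΔΔ′}
… and center `u_Δ = β Σ_{Δ′⊂Γ} (Σ_{Δ″∉Γ, Δ″ n.n. to Δ′} C^Γ_{ΔΔ″}) z_{Δ′}` (C.7).  C^Γ_{Δ,Δ′} is the covariance with “Ditrichelet boundary condition” on Γ."*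
— for the n.n. field, `C^Γ_{ΔΔ″} = 0` when Γ separates Δ from Δ″ (the Dirichlet walk cannot cross Γ, (C.3)), which is the Markov property §5 uses at
(5.13) p. 155 («the integral factorizes»).

WHAT IS PROVED (no definition, no named fact, no `sorry`; axioms standard).  `ι` finite, `A : Matrix ι ι ℝ` positive definite (e.g. from the class
hypotheses via `ClassAppendixC.posDef_of_coercive`), `Γ : Finset ι`, a side predicate `p` on `ι` with the SEPARATION hypothesis
`∀ z w ∉ Γ, ¬(p z ↔ p w) → A z w = 0` (no precision entry joins the two sides of `Γᶜ`; for a range-`r` precision: `Γ` an `r`-thick corridor):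
* `inv_apply_eq_zero_of_separated` — a square matrix over `ℝ` with a right inverse and no entries across a partition has an inverse with no entries
  across it (explicit right inverse + `Matrix.inv_eq_right_inv`);
* ★ `schur_eq_zero_of_separated` — the `condCov`-body `G_{yy′} − Σ_{c,c′∈Γ}G_{yc}(G_ΓΓ)⁻¹_{cc′}G_{c′y′}` VANISHES for `y, y′ ∉ Γ` on different sides
  (class form of «Γ-enclosed regions are conditionally uncorrelated», the covariance content of `iIndepFun_condField_of_enclosed`);
* ★ `regression_congr_of_separated` — the `condMean`-body at `y` (side `p`) is unchanged when the boundary data are modified at sites `c ∈ Γ` not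
  coupled (`A_{zc} = 0`) to any `z ∉ Γ` on `y`'s side (class form of `condMean_freeCov_congr_of_enclosed`);
* `regression_apply_eq_of_separated` — the boundary-sum form restricted to `y`'s side:
  `u_y = −Σ_{z∉Γ, p z} ((A|_{Γᶜ})⁻¹)_{yz} Σ_{c∈Γ} A_{zc}ξ_c` (class form of `condMean_freeCov_eq_boundary_sum`).

HONEST SCOPE.  Linear algebra of Gaussian conditioning; the measure-level statements (independence, disintegration) are generic-Gaussian and belong to
the kernel-generic editions of `B1Eq324BenfattoMarkov` §6 / `…Disintegration` (seat dag-n08-d's lane), not here.  Nothing of [Balaban1985UV3] asserted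
(whether its `Δ_k` has finite range across the §5 corridors is the in-edge N06 / [5] Sect. E); count-neutral for N08; nothing continuum / OS /
mass-gap / Clay.
-/

noncomputable section

open Finset Matrix
open scoped BigOperators

namespace Literature.MathematicalPhysics.QuantumFieldTheory.Balaban1983to89.B1Eq324BenfattoClassMarkov

open Literature.MathematicalPhysics.QuantumFieldTheory
open Literature.MathematicalPhysics.QuantumFieldTheory.Balaban1983to89.B1Eq324BenfattoClassAppendixC

variable {ι : Type*} [Fintype ι] [DecidableEq ι]

/-! ## §1  The inverse of a matrix with no entries across a partition has no entries across it -/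

/-- **Block-diagonal matrices have block-diagonal inverses** (two blocks given by a predicate): if `B` has a right inverse and
`B z w = 0` whenever `z`, `w` lie on different sides of `p`, then `B⁻¹ y y′ = 0` whenever `y`, `y′` lie on different sides — the explicit right
inverse `C′_{ab} = [p a ↔ p b]·B⁻¹_{ab}` works, and right inverses of square matrices are unique. [cite: HornJohnson2013, §0.7.3 and §0.9.2 (inverse of a
block diagonal / direct sum is the direct sum of the inverses)] -/
theorem inv_apply_eq_zero_of_separated {m : Type*} [Fintype m] [DecidableEq m] {B : Matrix m m ℝ} (hB : IsUnit B.det)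
    (p : m → Prop) [DecidablePred p] (hsep : ∀ z w, ¬ (p z ↔ p w) → B z w = 0)
    {y y' : m} (hy : ¬ (p y ↔ p y')) : B⁻¹ y y' = 0 := by
  set C' : Matrix m m ℝ := fun a b => if (p a ↔ p b) then B⁻¹ a b else 0 with hC'
  have hBB : B * B⁻¹ = 1 := Matrix.mul_nonsing_inv B hB
  have hright : B * C' = 1 := by
    ext a b
    rw [Matrix.mul_apply]
    have hterm : ∀ z, B a z * C' z b = if (p a ↔ p b) then B a z * B⁻¹ z b else 0 := by
      intro z
      simp only [hC']
      by_cases hzb : (p z ↔ p b) <;> by_cases hab : (p a ↔ p b)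
      · rw [if_pos hzb, if_pos hab]
      · rw [if_pos hzb, if_neg hab]
        have haz : ¬ (p a ↔ p z) := fun h => hab (h.trans hzb)
        rw [hsep a z haz, zero_mul]
      · rw [if_neg hzb, if_pos hab, mul_zero]
        have haz : ¬ (p a ↔ p z) := fun h => hzb (h.symm.trans hab)
        rw [hsep a z haz, zero_mul]
      · rw [if_neg hzb, if_neg hab, mul_zero]
    simp_rw [hterm]
    by_cases hab : (p a ↔ p b)
    · simp_rw [if_pos hab]
      rw [← Matrix.mul_apply, hBB]
    · simp_rw [if_neg hab]
      rw [Finset.sum_const_zero]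
      have hne : a ≠ b := fun h => hab (by rw [h])
      exact (Matrix.one_apply_ne hne).symm
  have hinv : B⁻¹ = C' := Matrix.inv_eq_right_inv hright
  rw [hinv]
  simp only [hC']
  rw [if_neg hy]

/-! ## §2  The Markov rows for the class: conditioning on a separating `Γ` -/

section Markov

variable {A : Matrix ι ι ℝ}

/-- The separation hypothesis on `A` passes to the principal block `A|_{Γᶜ}` read through the side predicate. [cite: BenfattoEtAl1978, Appendix C 2)
(C.6)–(C.7) p.164 (class form)] -/
private theorem submatrix_separated (Γ : Finset ι) (p : ι → Prop)
    (hsep : ∀ z w, z ∉ Γ → w ∉ Γ → ¬ (p z ↔ p w) → A z w = 0) (z w : ↥Γᶜ) (h : ¬ (p z ↔ p w)) :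
    (A.submatrix (fun j : ↥Γᶜ => (j : ι)) (fun j : ↥Γᶜ => (j : ι))) z w = 0 := by
  rw [Matrix.submatrix_apply]
  exact hsep z w (Finset.mem_compl.mp z.2) (Finset.mem_compl.mp w.2) h

/-- **The covariance-level MARKOV property for the class**: if no precision entry joins the two sides (`p` / `¬p`) of `Γᶜ`, then for
`y, y′ ∉ Γ` on different sides the conditional covariance given the coordinates in `Γ` — the `condCov`-body
`G_{yy′} − Σ_{c,c′∈Γ} G_{yc}(G_ΓΓ)⁻¹_{cc′}G_{c′y′}`, `G = A⁻¹` — VANISHES («C^Γ is the covariance with Dirichlet boundary condition on Γ»: the Dirichlet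
block `(A|_{Γᶜ})⁻¹` does not cross `Γ`).  Class form of the covariance content of `B1Eq324BenfattoMarkov.iIndepFun_condField_of_enclosed`.
[cite: BenfattoEtAl1978, Appendix C 2) (C.6)–(C.7) p.164 and (5.13) p.155 (class form)] -/
theorem schur_eq_zero_of_separated (hA : A.PosDef) (Γ : Finset ι) (p : ι → Prop) [DecidablePred p]
    (hsep : ∀ z w, z ∉ Γ → w ∉ Γ → ¬ (p z ↔ p w) → A z w = 0) (y y' : ↥Γᶜ) (hy : ¬ (p y ↔ p y')) :
    A⁻¹ y y' - ∑ c : Γ, ∑ c' : Γ, A⁻¹ y c * (covGram (A⁻¹ : Matrix ι ι ℝ) Γ)⁻¹ c c' * A⁻¹ c' y' = 0 := by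
  rw [schur_eq_inv_submatrix_compl hA Γ y y']
  exact inv_apply_eq_zero_of_separated (isUnit_det_submatrix_compl hA Γ) (fun j : ↥Γᶜ => p (j : ι))
    (fun z w h => submatrix_separated Γ p hsep z w h) hy

/-- **The boundary-sum form of the conditional centre, restricted to one side**: for `y ∉ Γ` with `p y`,
`Σ_{c,c′∈Γ} G_{yc}(G_ΓΓ)⁻¹_{cc′}ξ_{c′} = −Σ_{z∉Γ, p z} ((A|_{Γᶜ})⁻¹)_{yz} Σ_{c∈Γ} A_{zc}ξ_c` — only the Dirichlet block of `y`'s own side and the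
boundary data coupled to that side enter.  Class form of `B1Eq324BenfattoMarkov.condMean_freeCov_eq_boundary_sum`.
[cite: BenfattoEtAl1978, Appendix C (C.7) p.164 (class form)] -/
theorem regression_apply_eq_of_separated (hA : A.PosDef) (Γ : Finset ι) (p : ι → Prop) [DecidablePred p]
    (hsep : ∀ z w, z ∉ Γ → w ∉ Γ → ¬ (p z ↔ p w) → A z w = 0) (ξ : ι → ℝ) (y : ↥Γᶜ) (hy : p y) :
    ∑ c : Γ, ∑ c' : Γ, A⁻¹ y c * (covGram (A⁻¹ : Matrix ι ι ℝ) Γ)⁻¹ c c' * ξ c' =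
      -∑ z : ↥Γᶜ, if p z then
        (A.submatrix (fun j : ↥Γᶜ => (j : ι)) (fun j : ↥Γᶜ => (j : ι)))⁻¹ y z * ∑ c : Γ, A z c * ξ c else 0 := by
  rw [regression_apply_eq hA Γ ξ y]
  congr 1
  refine Finset.sum_congr rfl fun z _ => ?_
  by_cases hz : p z
  · rw [if_pos hz]
  · rw [if_neg hz]
    have hyz : ¬ (p (y : ι) ↔ p (z : ι)) := fun h => hz (h.mp hy)
    rw [inv_apply_eq_zero_of_separated (isUnit_det_submatrix_compl hA Γ) (fun j : ↥Γᶜ => p (j : ι))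
      (fun a b h => submatrix_separated Γ p hsep a b h) hyz, zero_mul]

/-- **Locality of the conditional centre for the class**: for `y ∉ Γ` on side `p`, the `condMean`-body `Σ_{c,c′∈Γ} G_{yc}(G_ΓΓ)⁻¹_{cc′}ξ_{c′}` is
unchanged if the boundary data `ξ` are modified at sites `c ∈ Γ` that are not coupled by `A` to any `z ∉ Γ` on side `p` — «the conditional mean
inside an enclosed region reads only the boundary data adjacent to it».  Class form of `B1Eq324BenfattoMarkov.condMean_freeCov_congr_of_enclosed`.
[cite: BenfattoEtAl1978, Appendix C (C.7) p.164 (class form)] -/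
theorem regression_congr_of_separated (hA : A.PosDef) (Γ : Finset ι) (p : ι → Prop) [DecidablePred p]
    (hsep : ∀ z w, z ∉ Γ → w ∉ Γ → ¬ (p z ↔ p w) → A z w = 0) (ξ ξ' : ι → ℝ)
    (hξ : ∀ c ∈ Γ, (∃ z, z ∉ Γ ∧ p z ∧ A z c ≠ 0) → ξ c = ξ' c) (y : ↥Γᶜ) (hy : p y) :
    ∑ c : Γ, ∑ c' : Γ, A⁻¹ y c * (covGram (A⁻¹ : Matrix ι ι ℝ) Γ)⁻¹ c c' * ξ c' =
      ∑ c : Γ, ∑ c' : Γ, A⁻¹ y c * (covGram (A⁻¹ : Matrix ι ι ℝ) Γ)⁻¹ c c' * ξ' c' := by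
  rw [regression_apply_eq_of_separated hA Γ p hsep ξ y hy, regression_apply_eq_of_separated hA Γ p hsep ξ' y hy]
  congr 1
  refine Finset.sum_congr rfl fun z _ => ?_
  by_cases hz : p z
  · rw [if_pos hz, if_pos hz]
    congr 1
    refine Finset.sum_congr rfl fun c _ => ?_
    by_cases hAzc : A z c = 0
    · rw [hAzc, zero_mul, zero_mul]
    · rw [hξ c c.2 ⟨z, Finset.mem_compl.mp z.2, hz, hAzc⟩]
  · rw [if_neg hz, if_neg hz]

end Markov

end Literature.MathematicalPhysics.QuantumFieldTheory.Balaban1983to89.B1Eq324BenfattoClassMarkov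

end
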